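import Literature.Geometry.Riemannian.IsometryTransportSobolev
import Literature.Geometry.Lorentzian.RiemannianVolumeIsometry
import Literature.Geometry.Manifold.OpenSubmanifoldMFDeriv
import HarnessLib

/-!
# The restriction of a Riemannian metric to an open-and-closed submanifold

Support file (all results proved) for removing the connectedness hypothesis from the finiteness
theorem for `L²` harmonic `1`-forms (`module_finite_l2HarmonicOneForms_of_boundarylessManifold`,
Carron's memoir, Thm. 4.3), by working on the connected components, which are open-and-closed
submanifolds. For an open subset `U : Opens X` (Mathlib's open-submanifold structure, with
`T_u U = T_u X = E` definitionally and `d(Subtype.val) = id`, `OpenSubmanifoldMFDeriv.lean`) and a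
smooth Riemannian metric `h` on `X`:

* `exists_contMDiffRiemannianMetric_opens` — **the restricted metric** `h|_U`: a smooth
  Riemannian metric `hU` on `U` equal to the pullback `(Subtype.val)^* h`
  (`PseudoRiemannianMetric.comap`), so that all naturality statements of the tree for pullback
  metrics (Levi-Civita connection, curvature, `∇α`, traces) apply to `U ⊆ X`;
* `val_opens`, `norm_opens` — `hU_u(v, w) = h_u(v, w)`, `‖v‖_{hU} = ‖v‖_h`;
* `riemannianEDist_opens_le`, `riemannianEDist_opens_eq` — the length distance of `U` dominates
  that of `X`, with **equality when `U` is also closed** (a `C¹` path of `X` between points of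
  `U` has connected image, hence stays in the open-and-closed `U`);
* `riemannianMeasure_image_val_opens`, `riemannianMeasure_opens_eq_comap`, `lintegral_opens` —
  for open-and-closed `U` the inclusion is an isometric embedding of the length metrics, so
  **`dV_{hU}` is the restriction of `dV_h`** (isometries preserve Hausdorff measures,
  Federer 1969, §2.10.11): `∫_U f dV_{hU} = ∫_{x ∈ U} f dV_h`.

O'Neill 1983, Ch. 3, p. 57 (open submanifolds are semi-Riemannian submanifolds with the
restricted metric) and Ch. 5, Def. 15 ff.; Federer 1969, §2.10.11. Everything is proved; no
definitions, no named facts (D-0026).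

## References

* B. O'Neill, *Semi-Riemannian geometry*, Academic Press 1983, Ch. 3, p. 57; Ch. 5, Def. 15.
  [`ONeill1983`]
* H. Federer, *Geometric Measure Theory*, Springer 1969, §2.10.11. [`Federer1969`]
-/

noncomputable section

open Bundle Set Function Filter Topology MeasureTheory Manifold
open scoped Manifold ContDiff ENNReal NNReal

namespace Literature.Geometry.Riemannian

open Literature.Geometry.Lorentzian
open Literature.Geometry.Lorentzian.PseudoRiemannianMetric
open Literature.Geometry.Manifold

variable {E : Type*} [NormedAddCommGroup E] [NormedSpace ℝ E] {H : Type*} [TopologicalSpace H]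
  {I : ModelWithCorners ℝ E H} {X : Type*} [TopologicalSpace X] [ChartedSpace H X]
  [IsManifold I ∞ X] [FiniteDimensional ℝ E]
  (h : ContMDiffRiemannianMetric I ∞ E (TangentSpace I : X → Type _))
  (U : TopologicalSpace.Opens X)

/-! ### The inclusion -/

omit [IsManifold I ∞ X] [FiniteDimensional ℝ E] in
/-- The differential of the inclusion of an open submanifold is injective (it is the identity,
`OpenSubmanifold.mfderiv_subtype_val`). [folklore] -/
theorem injective_mfderiv_subtype_val (u : U) :
    Function.Injective (mfderiv I I (Subtype.val : U → X) u) := by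
  rw [OpenSubmanifold.mfderiv_subtype_val]
  exact fun a b hab ↦ hab

omit [IsManifold I ∞ X] [FiniteDimensional ℝ E] in
/-- A map into an open submanifold is `C^n` within a set iff its composition with the inclusion
is (Mathlib's `ContMDiffWithinAt.subtypeVal_comp_iff`, stated there for `n = ∞`, holds for every
`n`). [folklore] -/
theorem contMDiffWithinAt_subtypeVal_comp_iff {E' : Type*} [NormedAddCommGroup E']
    [NormedSpace ℝ E'] {H' : Type*} [TopologicalSpace H'] {I' : ModelWithCorners ℝ E' H'}
    {M : Type*} [TopologicalSpace M] [ChartedSpace H' M] {n : ℕ∞ω} (f : M → U) (s : Set M)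
    (x : M) :
    ContMDiffWithinAt I' I n (Subtype.val ∘ f) s x ↔ ContMDiffWithinAt I' I n f s x :=
  ChartedSpace.liftPropWithinAt_subtypeVal_comp_iff ..

/-! ### The restricted metric -/

/-- **The restricted metric.** For a smooth Riemannian metric `h` on `X` and an open subset
`U`, there is a smooth Riemannian metric `hU` on the open submanifold `U` which is the pullback
of `h` along the inclusion: `hU = (Subtype.val)^* h` as pseudo-Riemannian metrics
(`PseudoRiemannianMetric.comap`; positive definite since `d(Subtype.val) = id` is injective).
O'Neill 1983, Ch. 3, p. 57. [cite: ONeill1983, Ch. 3, p. 57] -/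
theorem exists_contMDiffRiemannianMetric_opens :
    ∃ hU : ContMDiffRiemannianMetric I ∞ E (TangentSpace I : U → Type _),
      ofRiemannian hU = (ofRiemannian h).comap contMDiff_pullbackBilin_holds Subtype.val
        contMDiff_subtype_val (injective_mfderiv_subtype_val U) rfl := by
  set g := ofRiemannian h with hgdef
  set gU := g.comap contMDiff_pullbackBilin_holds Subtype.val
    contMDiff_subtype_val (injective_mfderiv_subtype_val U) rfl with hgU
  have hgUr : gU.IsRiemannian := by
    intro y v hv
    show 0 < (g.comap contMDiff_pullbackBilin_holds Subtype.val
      contMDiff_subtype_val (injective_mfderiv_subtype_val U) rfl).val y v v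
    rw [val_comap, pullbackBilin_apply]
    refine isRiemannian_ofRiemannian h _ _ fun h0 ↦ hv (injective_mfderiv_subtype_val U y ?_)
    rw [map_zero]; exact h0
  refine ⟨gU.toContMDiffRiemannianMetric hgUr, ?_⟩
  ext; rfl

variable {h U}
variable {hU : ContMDiffRiemannianMetric I ∞ E (TangentSpace I : U → Type _)}

/-- The restricted metric at `u : U` is the metric at `↑u`: `hU_u(v, w) = h_u(v, w)`.
[cite: ONeill1983, Ch. 3, p. 57] -/
theorem val_opens (hUeq : ofRiemannian hU = (ofRiemannian h).comap contMDiff_pullbackBilin_holds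
      Subtype.val contMDiff_subtype_val (injective_mfderiv_subtype_val U) rfl)
    (u : U) (v w : TangentSpace I u) :
    (ofRiemannian hU).val u v w = (ofRiemannian h).val u.1 v w := by
  rw [hUeq, val_comap, pullbackBilin_apply, OpenSubmanifold.mfderiv_subtype_val]
  rfl

/-- `hU.inner u v w = h.inner ↑u v w`. [cite: ONeill1983, Ch. 3, p. 57] -/
theorem inner_opens (hUeq : ofRiemannian hU = (ofRiemannian h).comap contMDiff_pullbackBilin_holds
      Subtype.val contMDiff_subtype_val (injective_mfderiv_subtype_val U) rfl)
    (u : U) (v w : TangentSpace I u) :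
    hU.inner u v w = h.inner u.1 v w :=
  val_opens hUeq u v w

/-- The norms of tangent vectors agree: `‖v‖_{hU} = ‖v‖_h`. [cite: ONeill1983, Ch. 3, p. 57] -/
theorem norm_opens (hUeq : ofRiemannian hU = (ofRiemannian h).comap contMDiff_pullbackBilin_holds
      Subtype.val contMDiff_subtype_val (injective_mfderiv_subtype_val U) rfl)
    (u : U) (v : TangentSpace I u) :
    (letI : RiemannianBundle (fun u : U ↦ TangentSpace I u) :=
        ⟨hU.toContinuousRiemannianMetric.toRiemannianMetric⟩; ‖v‖) =
      (letI : RiemannianBundle (fun x : X ↦ TangentSpace I x) :=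
        ⟨h.toContinuousRiemannianMetric.toRiemannianMetric⟩;
        ‖(show TangentSpace I u.1 from v)‖) := by
  rw [norm_eq_sqrt_inner_of_riemannianMetric hU, norm_eq_sqrt_inner_of_riemannianMetric h,
    inner_opens hUeq]

/-! ### The length distances -/

section Dist

/-- **The inclusion does not increase the length distance**: `d_X(u, u') ≤ d_U(u, u')` (paths
of `U` are paths of `X` of the same length). [cite: ONeill1983, Ch. 5, Def. 15] -/
theorem riemannianEDist_opens_le
    (hUeq : ofRiemannian hU = (ofRiemannian h).comap contMDiff_pullbackBilin_holds
      Subtype.val contMDiff_subtype_val (injective_mfderiv_subtype_val U) rfl)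
    (u u' : U) :
    (letI : RiemannianBundle (fun x : X ↦ TangentSpace I x) :=
        ⟨h.toContinuousRiemannianMetric.toRiemannianMetric⟩; riemannianEDist I u.1 u'.1) ≤
      (letI : RiemannianBundle (fun u : U ↦ TangentSpace I u) :=
        ⟨hU.toContinuousRiemannianMetric.toRiemannianMetric⟩; riemannianEDist I u u') := by
  letI iX : RiemannianBundle (fun x : X ↦ TangentSpace I x) :=
    ⟨h.toContinuousRiemannianMetric.toRiemannianMetric⟩
  letI iU : RiemannianBundle (fun u : U ↦ TangentSpace I u) :=
    ⟨hU.toContinuousRiemannianMetric.toRiemannianMetric⟩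
  haveI : IsManifold I 1 X := IsManifold.of_le (n := ∞) (by norm_num)
  have hle : ∀ (x : U) (v : TangentSpace I x), ‖mfderiv I I (Subtype.val : U → X) x v‖ ≤ ‖v‖ := by
    intro x v
    rw [OpenSubmanifold.mfderiv_subtype_val]
    exact le_of_eq (norm_opens hUeq x v).symm
  exact riemannianEDist_comp_le (Φ := (Subtype.val : U → X)) (I := I) (I' := I)
    (contMDiff_subtype_val (n := 1)) hle u u'

/-- **For an open-and-closed `U` the length distances agree**: `d_U(u, u') = d_X(u, u')`.
A `C¹` path of `X` from `u` to `u'`, reparametrised to be constant outside `[0, 1]`, has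
connected image meeting `U`, hence lies in the open-and-closed `U`, and lifts to a `C¹` path
of `U` of the same length. [cite: ONeill1983, Ch. 5, Def. 15] -/
theorem riemannianEDist_opens_eq (hUc : IsClosed (U : Set X))
    (hUeq : ofRiemannian hU = (ofRiemannian h).comap contMDiff_pullbackBilin_holds
      Subtype.val contMDiff_subtype_val (injective_mfderiv_subtype_val U) rfl)
    (u u' : U) :
    (letI : RiemannianBundle (fun u : U ↦ TangentSpace I u) :=
        ⟨hU.toContinuousRiemannianMetric.toRiemannianMetric⟩; riemannianEDist I u u') =
      (letI : RiemannianBundle (fun x : X ↦ TangentSpace I x) :=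
        ⟨h.toContinuousRiemannianMetric.toRiemannianMetric⟩; riemannianEDist I u.1 u'.1) := by
  letI iX : RiemannianBundle (fun x : X ↦ TangentSpace I x) :=
    ⟨h.toContinuousRiemannianMetric.toRiemannianMetric⟩
  letI iU : RiemannianBundle (fun u : U ↦ TangentSpace I u) :=
    ⟨hU.toContinuousRiemannianMetric.toRiemannianMetric⟩
  haveI : IsManifold I 1 X := IsManifold.of_le (n := ∞) (by norm_num)
  refine le_antisymm ?_ (riemannianEDist_opens_le hUeq u u')
  refine le_of_forall_gt_imp_ge_of_dense fun r hr ↦ ?_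
  obtain ⟨γ, hγ0, hγ1, hγ, hlen⟩ := exists_lt_of_riemannianEDist_lt hr
  -- reparametrise to be constant outside `[0, 1]`
  set γ' : ℝ → X := fun t ↦ γ (projIcc (0 : ℝ) 1 zero_le_one t : ℝ) with hγ'
  have hγ'eq : EqOn γ' γ (Icc 0 1) := fun t ht ↦ by
    simp only [hγ', projIcc_of_mem _ ht]
  have hγ's : CMDiff[Icc 0 1] 1 γ' := hγ.congr hγ'eq
  have hγ'0 : γ' 0 = u.1 := by rw [hγ'eq (left_mem_Icc.2 zero_le_one), hγ0]
  have hγ'1 : γ' 1 = u'.1 := by rw [hγ'eq (right_mem_Icc.2 zero_le_one), hγ1]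
  -- the image is connected and meets `U`, hence lies in `U`
  have hsub : range γ' ⊆ (U : Set X) := by
    have hconn : IsPreconnected (range γ') := by
      have : range γ' = γ '' Icc 0 1 := by
        ext x
        simp only [hγ', mem_range, mem_image]
        constructor
        · rintro ⟨t, rfl⟩; exact ⟨_, (projIcc (0 : ℝ) 1 zero_le_one t).2, rfl⟩
        · rintro ⟨t, ht, rfl⟩; exact ⟨t, by rw [projIcc_of_mem _ ht]⟩
      rw [this]
      exact isPreconnected_Icc.image γ hγ.continuousOn
    refine hconn.subset_isClopen ⟨hUc, U.isOpen⟩ ⟨u.1, ⟨0, hγ'0⟩, u.2⟩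
  -- the lifted path
  set γU : ℝ → U := fun t ↦ ⟨γ' t, hsub ⟨t, rfl⟩⟩ with hγU
  have hval : Subtype.val ∘ γU = γ' := funext fun t ↦ rfl
  have hγUs : CMDiff[Icc 0 1] 1 γU := fun t ht ↦
    (contMDiffWithinAt_subtypeVal_comp_iff U γU (Icc 0 1) t).1 (hval ▸ hγ's t ht)
  have hγU0 : γU 0 = u := Subtype.ext hγ'0
  have hγU1 : γU 1 = u' := Subtype.ext hγ'1
  calc riemannianEDist I u u' ≤ pathELength I γU 0 1 :=
        riemannianEDist_le_pathELength hγUs hγU0 hγU1 zero_le_one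
    _ = pathELength I (Subtype.val ∘ γU) 0 1 := by
        refine (pathELength_comp_eq (I := I) (I' := I) (Φ := (Subtype.val : U → X))
          (fun t _ ↦ (contMDiff_subtype_val (n := 1) _).mdifferentiableAt one_ne_zero)
          (fun t ht ↦ ?_) (fun t _ v ↦ ?_)).symm
        · exact ((hγUs t (Ioo_subset_Icc_self ht)).contMDiffAt
            (Icc_mem_nhds ht.1 ht.2)).mdifferentiableAt one_ne_zero
        · rw [OpenSubmanifold.mfderiv_subtype_val]
          exact (norm_opens hUeq _ v).symm
    _ = pathELength I γ 0 1 := by rw [hval]; exact pathELength_congr hγ'eq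
    _ ≤ r := hlen.le

/-- **The inclusion of an open-and-closed submanifold is an isometric embedding** of the length
metric spaces. [cite: ONeill1983, Ch. 5, Def. 15] -/
theorem isometry_subtype_val_opens [T3Space X] (hUc : IsClosed (U : Set X))
    (hUeq : ofRiemannian hU = (ofRiemannian h).comap contMDiff_pullbackBilin_holds
      Subtype.val contMDiff_subtype_val (injective_mfderiv_subtype_val U) rfl) :
    @Isometry U X
      (letI : RiemannianBundle (fun u : U ↦ TangentSpace I u) :=
        ⟨hU.toContinuousRiemannianMetric.toRiemannianMetric⟩;
        (EMetricSpace.ofRiemannianMetric I U).toPseudoEMetricSpace)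
      (letI : RiemannianBundle (fun x : X ↦ TangentSpace I x) :=
        ⟨h.toContinuousRiemannianMetric.toRiemannianMetric⟩;
        (EMetricSpace.ofRiemannianMetric I X).toPseudoEMetricSpace)
      (Subtype.val : U → X) :=
  fun u u' ↦ (riemannianEDist_opens_eq hUc hUeq u u').symm

end Dist

/-! ### The Riemannian measures -/

section Measure

variable [T3Space X] [MeasurableSpace X] [BorelSpace X]

/-- **The Riemannian measure of an open-and-closed submanifold is the restriction of the
Riemannian measure**: `dV_{hU}(s) = dV_h(s)` for `s ⊆ U` (the inclusion is an isometry of the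
length metrics and isometries preserve Hausdorff measures). Federer 1969, §2.10.11.
[cite: Federer1969, §2.10.11] -/
theorem riemannianMeasure_image_val_opens (hUc : IsClosed (U : Set X))
    (hUeq : ofRiemannian hU = (ofRiemannian h).comap contMDiff_pullbackBilin_holds
      Subtype.val contMDiff_subtype_val (injective_mfderiv_subtype_val U) rfl)
    (s : Set U) :
    riemannianMeasure h (Subtype.val '' s) = riemannianMeasure hU s := by
  haveI : IsManifold I 1 X := IsManifold.of_le (n := ∞) (by norm_num)
  letI iU : RiemannianBundle (fun u : U ↦ TangentSpace I u) :=
    ⟨hU.toContinuousRiemannianMetric.toRiemannianMetric⟩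
  letI iX : RiemannianBundle (fun x : X ↦ TangentSpace I x) :=
    ⟨h.toContinuousRiemannianMetric.toRiemannianMetric⟩
  let mU : EMetricSpace U := EMetricSpace.ofRiemannianMetric I U
  let mX : EMetricSpace X := EMetricSpace.ofRiemannianMetric I X
  have hI := isometry_subtype_val_opens hUc hUeq
  exact @Isometry.euclideanHausdorffMeasure_image U X mU _ _ mX _ _ _ _ hI s

/-- `dV_{hU} = (Subtype.val)^* dV_h` (pullback measure along the inclusion).
[cite: Federer1969, §2.10.11] -/
theorem riemannianMeasure_opens_eq_comap (hUc : IsClosed (U : Set X))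
    (hUeq : ofRiemannian hU = (ofRiemannian h).comap contMDiff_pullbackBilin_holds
      Subtype.val contMDiff_subtype_val (injective_mfderiv_subtype_val U) rfl) :
    riemannianMeasure hU = (riemannianMeasure h).comap Subtype.val := by
  refine Measure.ext fun s _ ↦ ?_
  have h1 : (riemannianMeasure h).comap Subtype.val s = riemannianMeasure h (Subtype.val '' s) :=
    (MeasurableEmbedding.subtype_coe U.isOpen.measurableSet).comap_apply _ _
  rw [h1, riemannianMeasure_image_val_opens hUc hUeq]

/-- **Integration over an open-and-closed submanifold**: `∫_U f(↑u) dV_{hU} = ∫_{x ∈ U} f dV_h`.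
[cite: Federer1969, §2.10.11] -/
theorem lintegral_opens (hUc : IsClosed (U : Set X))
    (hUeq : ofRiemannian hU = (ofRiemannian h).comap contMDiff_pullbackBilin_holds
      Subtype.val contMDiff_subtype_val (injective_mfderiv_subtype_val U) rfl)
    (f : X → ℝ≥0∞) :
    ∫⁻ u, f u.1 ∂riemannianMeasure hU = ∫⁻ x in (U : Set X), f x ∂riemannianMeasure h := by
  rw [riemannianMeasure_opens_eq_comap hUc hUeq]
  exact lintegral_subtype_comap U.isOpen.measurableSet f

end Measure

end Literature.Geometry.Riemannian

end
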